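import Literature.AlgebraicGeometry.Resolution.DifferentialOperators
import Literature.AlgebraicGeometry.Resolution.HasseSchmidtDerivatives
import Literature.AlgebraicGeometry.Resolution.PolynomialDiffOpOrder
import Mathlib.RingTheory.MvPolynomial.Expand
import Mathlib.Algebra.CharP.Frobenius
import HarnessLib

/-!
# Hasse–Schmidt derivatives on affine `σ`-space: exact order of `D^{(k e_i)}`, `Diff_{K[x_σ]/K}` is not finitely
# generated, and in characteristic `p` the `D^{(α)}` with `p^e ∤ α` kill all `p^e`-th powers

Topic: `Literature/AlgebraicGeometry/Resolution` — MULTIVARIATE companion of `PolynomialDiffOpOrder.lean` (the same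
facts for Mathlib's one-variable `Polynomial.hasseDeriv`) over the tree's `hasseDeriv R α : MvPolynomial σ R →ₗ[R]
MvPolynomial σ R` of `HasseSchmidtDerivatives.lean` (where `D^{(α)} ∈ Diff^{≤ |α|}` is proved) and Grothendieck's
`IsDiffOpLE` / `diffOp` of `DifferentialOperators.lean` (EGA IV₄ 16.8.8 (b)); finite generation of each
`Diff^{≤ m}_{K[x_σ]/K}` is `MvPolynomialDiffOpFG.lean`. Proved here, from the commutator definition:

* `not_isDiffOpLE_hasseDeriv_single_of_lt`, `hasseDeriv_single_mem_diffOp_iff` — over a NONTRIVIAL `K`,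
  **`D^{(k e_i)}` has order exactly `k`** (`x_i^k ∈ 𝔪^k` is sent to `1`, which `IsDiffOpLE.apply_mem_pow_sub`
  would put in `𝔪^{k−n} ⊆ 𝔪` for `n < k`); hence `not_fg_iSup_diffOp_mvPolynomial`: **`Diff_{K[x_σ]/K} =
  ⨆_m Diff^{≤ m}` is not a finitely generated `K[x_σ]`-module** as soon as `σ` is inhabited (every characteristic;
  via `PolynomialDiffOpOrder.not_fg_of_unbounded_order`).
* Characteristic `p`: `hasseDeriv_apply_pow_primePow` — **`D^{(α)}(f^{p^e}) = 0` whenever `p^e ∤ α_i` for some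
  `i`** (the Taylor morphism is a ring map: Mathlib `MvPolynomial.map_iterateFrobenius_expand` +
  `coeff_expand_of_not_dvd`); `hasseDeriv_apply_iterateFrobenius` restates it for `iterateFrobenius`. Such
  operators kill the subring of `p^e`-th powers WITHOUT being linear over it —
  `hasseDeriv_single_not_frobeniusLinear`: `D^{((p^e+1)e_i)}(x_i^{p^e}·x_i) = 1 ≠ 0 = x_i^{p^e}·D^{((p^e+1)e_i)}(x_i)`
  (this is why the module «differential operators `∂` with `∂ρ^e(𝒪) = 0`» has unbounded order, cf. the
  Hironaka-2017 adjudication row R67).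

What is NOT here: the exact order of `D^{(α)}` for a general multi-index (only `α = k e_i`), the basis theorem
(`HasseSchmidtDerivatives.hasseSchmidtDiff_eq_diffOp`, a named fact), smooth algebras other than polynomial rings.

Sources: [EGAIV4] A. Grothendieck, J. Dieudonné, ÉGA IV₄, Publ. Math. IHÉS 32 (1967), Déf. 16.8.1, Prop. 16.8.8,
Thm. 16.11.2 (16.11.2.1: `D_p(z^q) = (q choose p) z^{q−p}`). The characteristic-`p` annihilation statement is
the multivariate form of `PolynomialDiffOpOrder.polyHasseDeriv_pow_char_pow`, a corollary of (16.11.2.1)–(16.11.2.2) read in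
characteristic `p`.
-/

noncomputable section

open MvPolynomial

namespace Literature.AlgebraicGeometry.Resolution

universe u v

/-! ## Exact order of `D^{(k e_i)}`; `Diff_{K[x_σ]/K}` is not finitely generated -/

section ExactOrder

variable (K : Type u) [CommRing K] {σ : Type v}

/-- `x_i ∈ 𝔪 = (x_j)_j`. [folklore] -/
private theorem X_mem_idealOfVars (i : σ) : (X i : MvPolynomial σ K) ∈ idealOfVars σ K :=
  Ideal.subset_span (Set.mem_range_self i)

/-- `D^{(k e_i)} (x_i^k) = 1`. [cite: EGAIV4, Thm. 16.11.2 (16.11.2.1: D_p(z^q) = (q choose p) z^{q−p})] -/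
theorem hasseDeriv_single_X_pow_self [DecidableEq σ] (i : σ) (k : ℕ) :
    hasseDeriv K (Finsupp.single i k) (X i ^ k : MvPolynomial σ K) = 1 := by
  rw [hasseDeriv_X_pow, Nat.choose_self, Nat.cast_one, one_mul, Nat.sub_self, pow_zero]

/-- **Over a nontrivial ring, `D^{(k e_i)}` is not of order `≤ n` for `n < k`**: it sends `x_i^k ∈ 𝔪^k` to `1`,
which by `IsDiffOpLE.apply_mem_pow_sub` would lie in `𝔪^{k−n} ⊆ 𝔪`. [cite: EGAIV4, Thm. 16.11.2 (the D_q with |q| = k are not combinations of those with |q| < k)] -/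
theorem not_isDiffOpLE_hasseDeriv_single_of_lt [Nontrivial K] [DecidableEq σ] (i : σ) {n k : ℕ}
    (hk : n < k) : ¬ IsDiffOpLE K n (hasseDeriv K (Finsupp.single i k)) := by
  intro h
  have h1 : hasseDeriv K (Finsupp.single i k) (X i ^ k : MvPolynomial σ K) ∈ idealOfVars σ K ^ (k - n) :=
    IsDiffOpLE.apply_mem_pow_sub (idealOfVars σ K) k h (Ideal.pow_mem_pow (X_mem_idealOfVars K i) k)
  rw [hasseDeriv_single_X_pow_self] at h1
  have h2 : (1 : MvPolynomial σ K) ∈ idealOfVars σ K := by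
    have hle : idealOfVars σ K ^ (k - n) ≤ idealOfVars σ K ^ 1 := Ideal.pow_le_pow_right (by omega)
    simpa using hle h1
  have h0 := coeff_zero_eq_zero_of_mem_idealOfVars K h2
  simp at h0

/-- **`D^{(k e_i)}` has order exactly `k`** (`K` nontrivial): `D^{(k e_i)} ∈ Diff^{≤ n} ↔ k ≤ n`.
[cite: EGAIV4, Thm. 16.11.2] -/
theorem hasseDeriv_single_mem_diffOp_iff [Nontrivial K] [DecidableEq σ] (i : σ) {n k : ℕ} :
    hasseDeriv K (Finsupp.single i k) ∈ diffOp K (MvPolynomial σ K) n ↔ k ≤ n := by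
  constructor
  · intro h
    by_contra hlt
    exact not_isDiffOpLE_hasseDeriv_single_of_lt K i (by omega) h
  · intro h
    have := isDiffOpLE_hasseDeriv K n (Finsupp.single i k) (by rwa [Finsupp.degree_single])
    exact this

/-- **`Diff_{K[x_σ]/K} = ⨆_m Diff^{≤ m}` is not a finitely generated `K[x_σ]`-module** as soon as `σ` is inhabited
and `K` is nontrivial (every characteristic): it contains the `D^{(k e_i)}`, of unbounded order.
[cite: EGAIV4, Déf. 16.8.1 and Thm. 16.11.2] -/
theorem not_fg_iSup_diffOp_mvPolynomial [Nontrivial K] [DecidableEq σ] (i : σ) :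
    ¬ (⨆ m : ℕ, diffOp K (MvPolynomial σ K) m).FG :=
  not_fg_of_unbounded_order le_rfl fun M =>
    ⟨hasseDeriv K (Finsupp.single i (M + 1)),
      Submodule.mem_iSup_of_mem (M + 1) ((hasseDeriv_single_mem_diffOp_iff K i).2 le_rfl),
      not_isDiffOpLE_hasseDeriv_single_of_lt K i (Nat.lt_succ_self M)⟩

end ExactOrder

/-! ## Characteristic `p`: `D^{(α)}` annihilates `p^e`-th powers unless `p^e ∣ α` -/

section CharP

variable (K : Type u) [CommRing K] (p : ℕ) [Fact p.Prime] [CharP K p] {σ : Type v}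

/-- **`D^{(α)}(f^{p^e}) = 0` whenever `p^e ∤ α_i` for some `i`** (characteristic `p`): the Taylor morphism is a ring
map, so `(f(x+u))^{p^e}` is the `p^e`-fold expansion of a polynomial in `u` with Frobenius-twisted coefficients and
has no monomial `u^α` unless `p^e ∣ α`. (Corollary, in characteristic `p`, of the Taylor-coefficient definition
of the `D_q`.) [cite: EGAIV4, Thm. 16.11.2 ((16.11.2.1)–(16.11.2.2): D_q(z^n) = (n choose q) z^{n−q}, Leibniz; read in characteristic p)] -/
theorem hasseDeriv_apply_pow_primePow (e : ℕ) {α : σ →₀ ℕ} {i : σ} (h : ¬ p ^ e ∣ α i)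
    (f : MvPolynomial σ K) : hasseDeriv K α (f ^ p ^ e) = 0 := by
  rw [hasseDeriv_apply, map_pow, ← MvPolynomial.map_iterateFrobenius_expand p (taylor K f) e, coeff_map,
    coeff_expand_of_not_dvd (p := p ^ e) (taylor K f) h, map_zero]

/-- The same against Mathlib's `iterateFrobenius`: `D^{(α)} (ρ^e g) = 0` for `p^e ∤ α_i`.
[cite: EGAIV4, Thm. 16.11.2 ((16.11.2.1), read in characteristic p)] -/
theorem hasseDeriv_apply_iterateFrobenius (e : ℕ) {α : σ →₀ ℕ} {i : σ} (h : ¬ p ^ e ∣ α i)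
    (g : MvPolynomial σ K) : hasseDeriv K α (iterateFrobenius (MvPolynomial σ K) p e g) = 0 := by
  rw [iterateFrobenius_def, hasseDeriv_apply_pow_primePow K p e h]

/-- **Killing the `p^e`-th powers does not make an operator linear over them**: for `e ≥ 1` the operator
`D = D^{((p^e+1) e_i)}` kills every `p^e`-th power (`p^e ∤ p^e + 1`), yet `D(x_i^{p^e} · x_i) = 1` while
`x_i^{p^e} · D(x_i) = 0` (`K` nontrivial) — both values by (16.11.2.1) `D_q(z^n) = (n choose q) z^{n−q}`.
[cite: EGAIV4, Thm. 16.11.2 ((16.11.2.1))] -/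
theorem hasseDeriv_single_not_frobeniusLinear [Nontrivial K] [DecidableEq σ] (i : σ) {e : ℕ} (he : 1 ≤ e) :
    (∀ f : MvPolynomial σ K, hasseDeriv K (Finsupp.single i (p ^ e + 1)) (f ^ p ^ e) = 0) ∧
      hasseDeriv K (Finsupp.single i (p ^ e + 1)) ((X i : MvPolynomial σ K) ^ p ^ e * X i) ≠
        (X i : MvPolynomial σ K) ^ p ^ e * hasseDeriv K (Finsupp.single i (p ^ e + 1)) (X i) := by
  have hpe : 2 ≤ p ^ e :=
    le_trans (Fact.out : p.Prime).two_le (Nat.le_self_pow (by omega) p)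
  have hndvd : ¬ p ^ e ∣ p ^ e + 1 := fun h => by
    have h1 : p ^ e ∣ (p ^ e + 1) - p ^ e := Nat.dvd_sub h (dvd_refl _)
    rw [show p ^ e + 1 - p ^ e = 1 by omega] at h1
    have := Nat.le_of_dvd Nat.one_pos h1
    omega
  refine ⟨fun f => hasseDeriv_apply_pow_primePow K p e (α := Finsupp.single i (p ^ e + 1)) (i := i)
    (by simpa using hndvd) f, ?_⟩
  have hL : hasseDeriv K (Finsupp.single i (p ^ e + 1)) ((X i : MvPolynomial σ K) ^ p ^ e * X i) = 1 := by
    rw [← pow_succ, hasseDeriv_single_X_pow_self]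
  have hR : hasseDeriv K (Finsupp.single i (p ^ e + 1)) (X i : MvPolynomial σ K) = 0 := by
    have h := hasseDeriv_X_pow K i (p ^ e + 1) 1 (σ := σ)
    rw [pow_one, Nat.choose_eq_zero_of_lt (by omega), Nat.cast_zero, zero_mul] at h
    exact h
  rw [hL, hR, mul_zero]
  exact one_ne_zero

end CharP

end Literature.AlgebraicGeometry.Resolution

end
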